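import Mathlib
import HarnessLib
import Summits.AtomisticToContinuum.Crystallization.Theorems.PricedLinkCensusSoftFourRingsCapCube1
import Summits.AtomisticToContinuum.Crystallization.Theorems.PricedLinkCensusSoftFourRingsCube2

/-!
# Soft four-rings, endgame: the frame around a type-O vertex (cuboctahedral branch)

Support file for `SoftFourRings` (route `PricedLinkCensus`, sub-problem `Crystallization`),
endgame step (E5) of the evidence file (§12.8), point-level form, under the hypothesis that EVERY
vertex is of type O (`hallO`).  Starting from type-O data `(a, b, c, d)` at `v`:

* `typeO_swap34` — swap inside the second bonded pair;
* `cube_frame` — after orienting `c, d`, there are points `x, y, a', b', c', d'` with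
  `N(a) = {v, b, x, a'}`, `N(b) = {v, a, y, b'}`, `N(c) = {v, d, x, c'}`, `N(d) = {v, c, y, d'}`,
  `N(x) = {a, a', c, c'}`, `N(y) = {b, b', d, d'}` (as type-O data), `x, y ∉ N[v]`, `x ≠ y`.

**`Cap` variant** (seat c3 of stmt-AtomisticToContinuum-14234): identical to `PricedLinkCensusSoftFourRingsCube2`, except that the
global Tammes-13 hypothesis `(hT : musinTarasov2012_tammes_thirteen)` is replaced by the LOCAL covering
property of the twelve directions, `hT : ∀ p, ‖p‖ = 1 → ∃ x ∈ X, dist p x < 0.957` (no empty cap of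
angular radius `57.18°`), which is all the two roots (`FacetCap`, `Interior`) ever used; the hT-free
lemmas are not repeated (the original file is imported for them).
-/

namespace Summit.AtomisticToContinuum.Crystallization.Theorems.Cap

open Real RealInnerProductSpace Literature.Geometry.DiscreteGeometry

section Pairs

end Pairs

section Setting

open scoped Classical in
/-- **The frame around a type-O vertex** (see the module docstring). -/
theorem cube_frame
    {X : Finset (EuclideanSpace ℝ (Fin 3))}
    {B : Finset (Finset (EuclideanSpace ℝ (Fin 3)))}
    (hT : ∀ p : EuclideanSpace ℝ (Fin 3), ‖p‖ = 1 → ∃ x ∈ X, dist p x < 0.957)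
    (hX1 : ∀ y ∈ X, ‖y‖ = 1)
    (hcard : X.card = 12)
    (hsepX : ∀ u ∈ X, ∀ u' ∈ X, u ≠ u' → ⟪u, u'⟫ ≤ 1 - 1 / (2 * (101 / 100 : ℝ) ^ 2))
    (hB : ∀ T ∈ B, ∃ u ∈ X, ∃ u' ∈ X, u ≠ u' ∧ 1 - (101 / 100 : ℝ) ^ 2 / 2 ≤ ⟪u, u'⟫ ∧ T = {u, u'})
    (hBcard : B.card = 24)
    (hdeg : ∀ v ∈ X, ∃ w : Fin 4 → EuclideanSpace ℝ (Fin 3), (∀ k, w k ∈ X) ∧ Function.Injective w ∧ (∀ k, w k ≠ v) ∧ (∀ k, ({v, w k} : Finset (EuclideanSpace ℝ (Fin 3))) ∈ B) ∧ ∀ y, ({v, y} : Finset (EuclideanSpace ℝ (Fin 3))) ∈ B → ∃ k, y = w k)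
    (hallO : ∀ u ∈ X, ∃ a b c d : EuclideanSpace ℝ (Fin 3), (∀ t, ({u, t} : Finset (EuclideanSpace ℝ (Fin 3))) ∈ B ↔ (t = a ∨ t = b ∨ t = c ∨ t = d)) ∧ (a ≠ b ∧ a ≠ c ∧ a ≠ d ∧ b ≠ c ∧ b ≠ d ∧ c ≠ d) ∧ ({a, b} : Finset (EuclideanSpace ℝ (Fin 3))) ∈ B ∧ ({c, d} : Finset (EuclideanSpace ℝ (Fin 3))) ∈ B ∧ ({a, c} : Finset (EuclideanSpace ℝ (Fin 3))) ∉ B ∧ ({a, d} : Finset (EuclideanSpace ℝ (Fin 3))) ∉ B ∧ ({b, c} : Finset (EuclideanSpace ℝ (Fin 3))) ∉ B ∧ ({b, d} : Finset (EuclideanSpace ℝ (Fin 3))) ∉ B) {v a b c₀ d₀ : EuclideanSpace ℝ (Fin 3)} (hv : v ∈ X)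
    (hN₀ : (∀ t, ({v, t} : Finset (EuclideanSpace ℝ (Fin 3))) ∈ B ↔ (t = a ∨ t = b ∨ t = c₀ ∨ t = d₀))) (hd₀ : (a ≠ b ∧ a ≠ c₀ ∧ a ≠ d₀ ∧ b ≠ c₀ ∧ b ≠ d₀ ∧ c₀ ≠ d₀))
    (hab : ({a, b} : Finset (EuclideanSpace ℝ (Fin 3))) ∈ B) (hcd₀ : ({c₀, d₀} : Finset (EuclideanSpace ℝ (Fin 3))) ∈ B)
    (hac₀ : ({a, c₀} : Finset (EuclideanSpace ℝ (Fin 3))) ∉ B) (had₀ : ({a, d₀} : Finset (EuclideanSpace ℝ (Fin 3))) ∉ B) (hbc₀ : ({b, c₀} : Finset (EuclideanSpace ℝ (Fin 3))) ∉ B) (hbd₀ : ({b, d₀} : Finset (EuclideanSpace ℝ (Fin 3))) ∉ B) :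
    ∃ c d x y a' b' c' d' : EuclideanSpace ℝ (Fin 3),
      ((∀ t, ({v, t} : Finset (EuclideanSpace ℝ (Fin 3))) ∈ B ↔ (t = a ∨ t = b ∨ t = c ∨ t = d)) ∧ (a ≠ b ∧ a ≠ c ∧ a ≠ d ∧ b ≠ c ∧ b ≠ d ∧ c ≠ d) ∧ ({a, b} : Finset (EuclideanSpace ℝ (Fin 3))) ∈ B ∧ ({c, d} : Finset (EuclideanSpace ℝ (Fin 3))) ∈ B ∧
        ({a, c} : Finset (EuclideanSpace ℝ (Fin 3))) ∉ B ∧ ({a, d} : Finset (EuclideanSpace ℝ (Fin 3))) ∉ B ∧ ({b, c} : Finset (EuclideanSpace ℝ (Fin 3))) ∉ B ∧ ({b, d} : Finset (EuclideanSpace ℝ (Fin 3))) ∉ B) ∧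
      ((∀ t, ({a, t} : Finset (EuclideanSpace ℝ (Fin 3))) ∈ B ↔ (t = v ∨ t = b ∨ t = x ∨ t = a')) ∧ (v ≠ b ∧ v ≠ x ∧ v ≠ a' ∧ b ≠ x ∧ b ≠ a' ∧ x ≠ a') ∧ ({x, a'} : Finset (EuclideanSpace ℝ (Fin 3))) ∈ B ∧
        ({v, x} : Finset (EuclideanSpace ℝ (Fin 3))) ∉ B ∧ ({v, a'} : Finset (EuclideanSpace ℝ (Fin 3))) ∉ B ∧ ({b, x} : Finset (EuclideanSpace ℝ (Fin 3))) ∉ B ∧ ({b, a'} : Finset (EuclideanSpace ℝ (Fin 3))) ∉ B) ∧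
      ((∀ t, ({b, t} : Finset (EuclideanSpace ℝ (Fin 3))) ∈ B ↔ (t = v ∨ t = a ∨ t = y ∨ t = b')) ∧ (v ≠ a ∧ v ≠ y ∧ v ≠ b' ∧ a ≠ y ∧ a ≠ b' ∧ y ≠ b') ∧ ({y, b'} : Finset (EuclideanSpace ℝ (Fin 3))) ∈ B ∧
        ({v, y} : Finset (EuclideanSpace ℝ (Fin 3))) ∉ B ∧ ({v, b'} : Finset (EuclideanSpace ℝ (Fin 3))) ∉ B ∧ ({a, y} : Finset (EuclideanSpace ℝ (Fin 3))) ∉ B ∧ ({a, b'} : Finset (EuclideanSpace ℝ (Fin 3))) ∉ B) ∧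
      ((∀ t, ({c, t} : Finset (EuclideanSpace ℝ (Fin 3))) ∈ B ↔ (t = v ∨ t = d ∨ t = x ∨ t = c')) ∧ (v ≠ d ∧ v ≠ x ∧ v ≠ c' ∧ d ≠ x ∧ d ≠ c' ∧ x ≠ c') ∧ ({x, c'} : Finset (EuclideanSpace ℝ (Fin 3))) ∈ B ∧
        ({v, x} : Finset (EuclideanSpace ℝ (Fin 3))) ∉ B ∧ ({v, c'} : Finset (EuclideanSpace ℝ (Fin 3))) ∉ B ∧ ({d, x} : Finset (EuclideanSpace ℝ (Fin 3))) ∉ B ∧ ({d, c'} : Finset (EuclideanSpace ℝ (Fin 3))) ∉ B) ∧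
      ((∀ t, ({d, t} : Finset (EuclideanSpace ℝ (Fin 3))) ∈ B ↔ (t = v ∨ t = c ∨ t = y ∨ t = d')) ∧ (v ≠ c ∧ v ≠ y ∧ v ≠ d' ∧ c ≠ y ∧ c ≠ d' ∧ y ≠ d') ∧ ({y, d'} : Finset (EuclideanSpace ℝ (Fin 3))) ∈ B ∧
        ({v, y} : Finset (EuclideanSpace ℝ (Fin 3))) ∉ B ∧ ({v, d'} : Finset (EuclideanSpace ℝ (Fin 3))) ∉ B ∧ ({c, y} : Finset (EuclideanSpace ℝ (Fin 3))) ∉ B ∧ ({c, d'} : Finset (EuclideanSpace ℝ (Fin 3))) ∉ B) ∧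
      ((∀ t, ({x, t} : Finset (EuclideanSpace ℝ (Fin 3))) ∈ B ↔ (t = a ∨ t = a' ∨ t = c ∨ t = c')) ∧ (a ≠ a' ∧ a ≠ c ∧ a ≠ c' ∧ a' ≠ c ∧ a' ≠ c' ∧ c ≠ c') ∧
        ({a, c} : Finset (EuclideanSpace ℝ (Fin 3))) ∉ B ∧ ({a, c'} : Finset (EuclideanSpace ℝ (Fin 3))) ∉ B ∧ ({a', c} : Finset (EuclideanSpace ℝ (Fin 3))) ∉ B ∧ ({a', c'} : Finset (EuclideanSpace ℝ (Fin 3))) ∉ B) ∧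
      ((∀ t, ({y, t} : Finset (EuclideanSpace ℝ (Fin 3))) ∈ B ↔ (t = b ∨ t = b' ∨ t = d ∨ t = d')) ∧ (b ≠ b' ∧ b ≠ d ∧ b ≠ d' ∧ b' ≠ d ∧ b' ≠ d' ∧ d ≠ d') ∧
        ({b, d} : Finset (EuclideanSpace ℝ (Fin 3))) ∉ B ∧ ({b, d'} : Finset (EuclideanSpace ℝ (Fin 3))) ∉ B ∧ ({b', d} : Finset (EuclideanSpace ℝ (Fin 3))) ∉ B ∧ ({b', d'} : Finset (EuclideanSpace ℝ (Fin 3))) ∉ B) ∧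
      (x ∈ X ∧ y ∈ X ∧ x ≠ v ∧ x ≠ a ∧ x ≠ b ∧ x ≠ c ∧ x ≠ d ∧
        y ≠ v ∧ y ≠ a ∧ y ≠ b ∧ y ≠ c ∧ y ≠ d ∧ x ≠ y) := by
  have hva : ({v, a} : Finset (EuclideanSpace ℝ (Fin 3))) ∈ B := (hN₀ a).2 (Or.inl rfl)
  have hvb : ({v, b} : Finset (EuclideanSpace ℝ (Fin 3))) ∈ B := (hN₀ b).2 (Or.inr (Or.inl rfl))
  have hα := alpha_of_allO hB hallO hva hvb hab
  -- orient `c, d` along the cells at `v`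
  obtain ⟨c, d, hN, hd, hcd, hac, had, hbc, hbd, x, hxX, hxv, hxa, hxb, hxc, hxd, hxaB, hxcB,
      y, hyX, hyv, hya, hyb, hyc, hyd, hybB, hydB⟩ :
      ∃ c d : EuclideanSpace ℝ (Fin 3), (∀ t, ({v, t} : Finset (EuclideanSpace ℝ (Fin 3))) ∈ B ↔ (t = a ∨ t = b ∨ t = c ∨ t = d)) ∧ (a ≠ b ∧ a ≠ c ∧ a ≠ d ∧ b ≠ c ∧ b ≠ d ∧ c ≠ d) ∧ ({c, d} : Finset (EuclideanSpace ℝ (Fin 3))) ∈ B ∧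
        ({a, c} : Finset (EuclideanSpace ℝ (Fin 3))) ∉ B ∧ ({a, d} : Finset (EuclideanSpace ℝ (Fin 3))) ∉ B ∧ ({b, c} : Finset (EuclideanSpace ℝ (Fin 3))) ∉ B ∧ ({b, d} : Finset (EuclideanSpace ℝ (Fin 3))) ∉ B ∧
        ∃ x ∈ X, x ≠ v ∧ x ≠ a ∧ x ≠ b ∧ x ≠ c ∧ x ≠ d ∧ ({x, a} : Finset (EuclideanSpace ℝ (Fin 3))) ∈ B ∧ ({x, c} : Finset (EuclideanSpace ℝ (Fin 3))) ∈ B ∧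
        ∃ y ∈ X, y ≠ v ∧ y ≠ a ∧ y ≠ b ∧ y ≠ c ∧ y ≠ d ∧ ({y, b} : Finset (EuclideanSpace ℝ (Fin 3))) ∈ B ∧ ({y, d} : Finset (EuclideanSpace ℝ (Fin 3))) ∈ B := by
    rcases typeO_cells hT hX1 hcard hsepX hB hBcard hdeg hv hN₀ hd₀ hab hcd₀ hac₀ had₀ hbc₀ hbd₀ hα
      with ⟨⟨x, hxX, h1, h2, h3, h4, h5, hB1, hB2⟩, ⟨y, hyX, k1, k2, k3, k4, k5, hB3, hB4⟩⟩ |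
        ⟨⟨x, hxX, h1, h2, h3, h4, h5, hB1, hB2⟩, ⟨y, hyX, k1, k2, k3, k4, k5, hB3, hB4⟩⟩
    · exact ⟨c₀, d₀, hN₀, hd₀, hcd₀, hac₀, had₀, hbc₀, hbd₀, x, hxX, h1, h2, h3, h4, h5, hB1, hB2,
        y, hyX, k1, k2, k3, k4, k5, hB3, hB4⟩
    · obtain ⟨hN', hd', -, hdc, had', hac', hbd', hbc'⟩ :=
        typeO_swap34 hN₀ hd₀ hab hcd₀ hac₀ had₀ hbc₀ hbd₀
      exact ⟨d₀, c₀, hN', hd', hdc, had', hac', hbd', hbc', x, hxX, h1, h2, h3, h5, h4, hB1, hB2,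
        y, hyX, k1, k2, k3, k5, k4, hB3, hB4⟩
  clear hN₀ hd₀ hcd₀ hac₀ had₀ hbc₀ hbd₀
  have hvc : ({v, c} : Finset (EuclideanSpace ℝ (Fin 3))) ∈ B := (hN c).2 (Or.inr (Or.inr (Or.inl rfl)))
  have hvd : ({v, d} : Finset (EuclideanSpace ℝ (Fin 3))) ∈ B := (hN d).2 (Or.inr (Or.inr (Or.inr rfl)))
  have haX : a ∈ X := (mem_of_mem_bonds hB hva).2
  have hbX : b ∈ X := (mem_of_mem_bonds hB hvb).2
  have hcX : c ∈ X := (mem_of_mem_bonds hB hvc).2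
  have hdX : d ∈ X := (mem_of_mem_bonds hB hvd).2
  have hvb' : v ≠ b := ne_of_mem_bonds hB hvb
  have hva' : v ≠ a := ne_of_mem_bonds hB hva
  have hvc' : v ≠ c := ne_of_mem_bonds hB hvc
  have hvd' : v ≠ d := ne_of_mem_bonds hB hvd
  have hxy : x ≠ y := fun h => hxv (hα x hxaB (by rw [h]; exact hybB))
  -- complete the data at `a, b, c, d`
  obtain ⟨pa, qa, ra, sa, hNa₀, hda₀, hB1a, hB2a, hn1a, hn2a, hn3a, hn4a⟩ := hallO a haX
  obtain ⟨a', hNa, hda, -, hxa', hvxn, hvapn, hbxn, hbapn⟩ :=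
    typeO_complete hNa₀ hda₀ hB1a hB2a hn1a hn2a hn3a hn4a hvb (by rw [Finset.pair_comm]; exact hva)
      hab hvb' (by rw [Finset.pair_comm]; exact hxaB) hxv hxb
  obtain ⟨pb, qb, rb, sb, hNb₀, hdb₀, hB1b, hB2b, hn1b, hn2b, hn3b, hn4b⟩ := hallO b hbX
  obtain ⟨b', hNb, hdb, -, hyb', hvyn, hvbpn, hayn, habpn⟩ :=
    typeO_complete hNb₀ hdb₀ hB1b hB2b hn1b hn2b hn3b hn4b hva (by rw [Finset.pair_comm]; exact hvb)
      (by rw [Finset.pair_comm]; exact hab) hva' (by rw [Finset.pair_comm]; exact hybB) hyv hya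
  obtain ⟨pc, qc, rc, sc, hNc₀, hdc₀, hB1c, hB2c, hn1c, hn2c, hn3c, hn4c⟩ := hallO c hcX
  obtain ⟨c', hNc, hdc, -, hxc', hvxn', hvcpn, hdxn, hdcpn⟩ :=
    typeO_complete hNc₀ hdc₀ hB1c hB2c hn1c hn2c hn3c hn4c hvd (by rw [Finset.pair_comm]; exact hvc)
      hcd hvd' (by rw [Finset.pair_comm]; exact hxcB) hxv hxd
  obtain ⟨pd, qd, rd, sd, hNd₀, hdd₀, hB1d, hB2d, hn1d, hn2d, hn3d, hn4d⟩ := hallO d hdX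
  obtain ⟨d', hNd, hdd, -, hyd', hvyn', hvdpn, hcyn, hcdpn⟩ :=
    typeO_complete hNd₀ hdd₀ hB1d hB2d hn1d hn2d hn3d hn4d hvc (by rw [Finset.pair_comm]; exact hvd)
      (by rw [Finset.pair_comm]; exact hcd) hvc' (by rw [Finset.pair_comm]; exact hydB) hyv hyc
  -- the data at `x` and `y`
  have haa' : ({a, a'} : Finset (EuclideanSpace ℝ (Fin 3))) ∈ B := (hNa a').2 (Or.inr (Or.inr (Or.inr rfl)))
  have hcc' : ({c, c'} : Finset (EuclideanSpace ℝ (Fin 3))) ∈ B := (hNc c').2 (Or.inr (Or.inr (Or.inr rfl)))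
  have hbb' : ({b, b'} : Finset (EuclideanSpace ℝ (Fin 3))) ∈ B := (hNb b').2 (Or.inr (Or.inr (Or.inr rfl)))
  have hdd' : ({d, d'} : Finset (EuclideanSpace ℝ (Fin 3))) ∈ B := (hNd d').2 (Or.inr (Or.inr (Or.inr rfl)))
  have ha'c : a' ≠ c := fun h => hac (h ▸ haa')
  have hc'a : c' ≠ a := fun h => hac (by rw [Finset.pair_comm]; exact h ▸ hcc')
  have hb'd : b' ≠ d := fun h => hbd (h ▸ hbb')
  have hd'b : d' ≠ b := fun h => hbd (by rw [Finset.pair_comm]; exact h ▸ hdd')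
  obtain ⟨px, qx, rx, sx, hNx₀, hdx₀, hB1x, hB2x, hn1x, hn2x, hn3x, hn4x⟩ := hallO x hxX
  obtain ⟨c'', hNx, hdxx, -, hcc'', hacx, hac'', ha'cx, ha'c''⟩ :=
    typeO_complete hNx₀ hdx₀ hB1x hB2x hn1x hn2x hn3x hn4x haa' hxaB hxa' (ne_of_mem_bonds hB haa')
      hxcB hd.2.1.symm ha'c.symm
  have hc'eq : c' = c'' := by
    rcases (hNx c').1 hxc' with h | h | h | h
    · exact absurd h hc'a
    · exact absurd (h ▸ hcc') (by rw [Finset.pair_comm]; exact ha'cx)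
    · exact absurd h (ne_of_mem_bonds hB hcc').symm
    · exact h
  rw [← hc'eq] at hNx hdxx hcc'' hac'' ha'c''
  obtain ⟨py, qy, ry, sy, hNy₀, hdy₀, hB1y, hB2y, hn1y, hn2y, hn3y, hn4y⟩ := hallO y hyX
  obtain ⟨d'', hNy, hdyy, -, hdd'', hbdy, hbd'', hb'dy, hb'd''⟩ :=
    typeO_complete hNy₀ hdy₀ hB1y hB2y hn1y hn2y hn3y hn4y hbb' hybB hyb' (ne_of_mem_bonds hB hbb')
      hydB hd.2.2.2.2.1.symm hb'd.symm
  have hd'eq : d' = d'' := by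
    rcases (hNy d').1 hyd' with h | h | h | h
    · exact absurd h hd'b
    · exact absurd (h ▸ hdd') (by rw [Finset.pair_comm]; exact hb'dy)
    · exact absurd h (ne_of_mem_bonds hB hdd').symm
    · exact h
  rw [← hd'eq] at hNy hdyy hdd'' hbd'' hb'd''
  exact ⟨c, d, x, y, a', b', c', d', ⟨hN, hd, hab, hcd, hac, had, hbc, hbd⟩,
    ⟨hNa, hda, hxa', hvxn, hvapn, hbxn, hbapn⟩, ⟨hNb, hdb, hyb', hvyn, hvbpn, hayn, habpn⟩,
    ⟨hNc, hdc, hxc', hvxn', hvcpn, hdxn, hdcpn⟩, ⟨hNd, hdd, hyd', hvyn', hvdpn, hcyn, hcdpn⟩,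
    ⟨hNx, hdxx, hacx, hac'', ha'cx, ha'c''⟩, ⟨hNy, hdyy, hbdy, hbd'', hb'dy, hb'd''⟩,
    ⟨hxX, hyX, hxv, hxa, hxb, hxc, hxd, hyv, hya, hyb, hyc, hyd, hxy⟩⟩

end Setting

end Summit.AtomisticToContinuum.Crystallization.Theorems.Cap
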